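import Mathlib
import Summits.NavierStokesRegularity.NavierStokesRegularity.Theorems.EulerZoomLiouvillePowerGaugeEulerLiouvilleCasimirHaulBook
import Summits.NavierStokesRegularity.NavierStokesRegularity.Theorems.EulerZoomLiouvillePowerGaugeEulerLiouvilleCasimirHaulHaulingInequality
import Summits.NavierStokesRegularity.NavierStokesRegularity.Theorems.EulerZoomLiouvillePowerGaugeEulerLiouvilleCasimirHaulTravel
import Summits.NavierStokesRegularity.NavierStokesRegularity.Theorems.EulerZoomLiouvillePowerGaugeEulerLiouvilleCasimirHaulRace
import Summits.NavierStokesRegularity.NavierStokesRegularity.Theorems.EulerZoomLiouvillePowerGaugeEulerLiouvilleCasimirHaulLedgerFlow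
import Summits.NavierStokesRegularity.NavierStokesRegularity.Theorems.EulerZoomLiouvillePowerGaugeEulerLiouvillePastIrrotational
import Literature.Analysis.FluidPDE.ClassicalSolution
import Literature.Analysis.FluidPDE.AxisymmetricEuler
import HarnessLib

/-!
# Crux `EulerZoomLiouville.PowerGaugeEulerLiouville` (stmt-NavierStokesRegularity-19832), width sub-line `casimir_haul` (ns-idea-11, REV4):
# THE CASIMIR MEMBER, CONDITIONAL ON THE HAULING INEQUALITY (H3)

Seat ns-sfl-p1 g10 (`--supports stmt-NavierStokesRegularity-19832 --as helper`).  `Lines/casimir_haul.lean` REV4 (sha16 952ce528a8285b32) is down to two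
sorries: H3 `stub_haulingInequality` (ns-ezl-w2 g7, landing chain in flight) and the wall H6.  This file assembles, in `Theorems/`, the line's in-file
conditional member `slabBoundedSwirlFree_trivial_of_h3` BY NAME over the landed width pieces — H1 `CasimirHaul.hasLedgerFlows_of_slabBoundedSwirlFree`
(ns-sfl-p1, p714362), H4a `CasimirHaul.haulTravel` (ns-sfl-p1, p715646), H4c `CasimirHaul.haulBook` (ns-sfl-p1, p716564; ns-idea-11's proof ported),
H4 `CasimirHaul.haulRace_filler` (ns-ezl-w3, the race), and the LEAD's endgame `PastIrrotational.ae_eq_zero_of_gauge_of_pastIrrotational` — with every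
line abbreviation δ-UNFOLDED (`HaulingInequality`, `InClass`, `IsSlabBoundedSwirlFree`, `VanishesAE`):

* ★ `slabBoundedSwirlFree_trivial_of_haulingInequality` — GIVEN the hauling inequality (H3's conclusion, as a hypothesis), every member of the crux
  class (`0 < ρ ≤ ½`) lying in the HAULABLE STRATUM (classical on the open past, axisymmetric swirl-free slices, velocity bounded on compact past slabs)
  VANISHES a.e. on the past: H1 gives ledger flows, H4 (= H4a travel + H4c bookkeeping + banishment race) makes every slice irrotational, and a
  classical irrotational divergence-free slice under the `A`-gauge is zero (the LEAD's endgame), so the suitable weak solution vanishes.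
The unconditional member (`… (hcls) (hs) : uncurry u =ᵐ 0`, the LEAD's v115 binder `¬ IsSlabBoundedSwirlFree u p`) is this theorem applied to
ns-ezl-w2's `CasimirHaul.haulingInequality` once it lands (to be appended here).

HONEST FRAMING: a CONDITIONAL stratum kill inside the crux class (conditional on H3; the wall H6 = the class minus this stratum stays OPEN); nothing
here bears on the crux E (19832 OPEN) as a whole or on NS regularity; no summit statement is proved by this file; not E.
[cite: CaffarelliKohnNirenberg1982, §2; MajdaBertozziCUP2002, §1.3, §2.3.3]
-/

noncomputable section

-- flat `Theorems/<Route><Decl>…` files of one crux share the namespace of the crux (tree convention)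
set_option linter.dupNamespace false

open MeasureTheory Set Filter Topology Metric Function
open scoped NNReal ENNReal

namespace Summit.NavierStokesRegularity.NavierStokesRegularity.Theorems.PowerGaugeEulerLiouville.CasimirHaul

open Literature.Analysis Literature.Analysis.FluidPDE
open Summit.NavierStokesRegularity.NavierStokesRegularity.Theorems.PowerGaugeEulerLiouville

/-- ★ **THE CASIMIR MEMBER, CONDITIONAL ON H3** (= `Lines/casimir_haul.lean` REV4 `slabBoundedSwirlFree_trivial_of_h3`, assembled over tree
theorems; `HaulingInequality`, `InClass`, `IsSlabBoundedSwirlFree`, `VanishesAE` δ-unfolded): if the hauling inequality holds, then every member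
`(u, p, H, c)` of the crux class with `0 < ρ ≤ ½` that is classical on the open past with axisymmetric swirl-free slices and velocity bounded on
compact past slabs satisfies `u = 0` a.e. on `(−∞,0) × ℝ³`.  Chain: `hasLedgerFlows_of_slabBoundedSwirlFree` (H1) → `haulRace_filler haulTravel
haulBook h3` (H4: every slice irrotational) → `PastIrrotational.ae_eq_zero_of_gauge_of_pastIrrotational` (the LEAD's endgame).
[cite: CaffarelliKohnNirenberg1982, §2; MajdaBertozziCUP2002, §2.3.3] -/
theorem slabBoundedSwirlFree_trivial_of_haulingInequality
    (h3 : ∃ C : ℝ, 0 < C ∧ ∀ b : ℝ, 1 ≤ b → ∀ v : EuclideanSpace ℝ (Fin 3) → EuclideanSpace ℝ (Fin 3), ContDiff ℝ 1 v →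
      ∀ w : ℝ → ℝ, Measurable w → (∀ z : ℝ, |w z| ≤ 1) →
        ∀ A : Set (EuclideanSpace ℝ (Fin 3)), MeasurableSet A → A ⊆ {x : EuclideanSpace ℝ (Fin 3) | cylRadius x < 2 * b ∧ |x 2| < b} →
          |∫ x in A, w (x 2) * (v x) 2| ≤
            C * Real.sqrt (∫ x in {x : EuclideanSpace ℝ (Fin 3) | cylRadius x < 2 * b ∧ |x 2| < b}, ‖fderiv ℝ v x‖ ^ 2) *
                Real.sqrt ((∫ x in A, cylRadius x ^ 2) * (1 + Real.log b + max 0 (Real.log (b / (∫ x in A, cylRadius x ^ 2))))) +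
              C * Real.sqrt ((∫ x in A, cylRadius x ^ 2) / b ^ 2) *
                Real.sqrt (∫ x in {x : EuclideanSpace ℝ (Fin 3) | cylRadius x < 2 * b ∧ |x 2| < b}, ‖v x‖ ^ 2))
    {ρ : ℝ} (hρ : 0 < ρ) (hρ2 : ρ ≤ 1 / 2)
    {u : ℝ → EuclideanSpace ℝ (Fin 3) → EuclideanSpace ℝ (Fin 3)} {p : ℝ → EuclideanSpace ℝ (Fin 3) → ℝ}
    {H : ℝ → EuclideanSpace ℝ (Fin 3) → EuclideanSpace ℝ (Fin 3) →L[ℝ] EuclideanSpace ℝ (Fin 3)} {c : ℝ≥0}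
    (hcls : IsSuitableWeakSolutionOn (slab (EuclideanSpace ℝ (Fin 3)) (Set.Iio 0) isOpen_Iio) 0 0 u p ∧
      HasWeakSpatialGradientOn (slab (EuclideanSpace ℝ (Fin 3)) (Set.Iio 0) isOpen_Iio) u H ∧
      (∀ a : ℝ, 0 < a →
        ENNReal.ofReal (a ^ (2 * ρ)) * cknA a (0 : ℝ × EuclideanSpace ℝ (Fin 3)) u +
            ENNReal.ofReal (a ^ ρ) * cknE a (0 : ℝ × EuclideanSpace ℝ (Fin 3)) H +
          ENNReal.ofReal (a ^ (2 * ρ)) * cknD a (0 : ℝ × EuclideanSpace ℝ (Fin 3)) p ≤ (c : ℝ≥0∞)))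
    (hs : IsClassicalEulerSolutionOn (Set.Iio 0) 0 u p ∧
      (∀ τ : ℝ, τ < 0 → IsAxisymmetric (u τ) ∧ HasNoSwirl (u τ)) ∧
      (∀ T₁ T₀ : ℝ, T₁ ≤ T₀ → T₀ < 0 → ∃ B : ℝ, ∀ τ ∈ Set.Icc T₁ T₀, ∀ x : EuclideanSpace ℝ (Fin 3), ‖u τ x‖ ≤ B)) :
    Function.uncurry u =ᵐ[volume.restrict (Set.Iio (0 : ℝ) ×ˢ (Set.univ : Set (EuclideanSpace ℝ (Fin 3))))] 0 := by
  have hcl : IsClassicalEulerSolutionOn (Set.Iio 0) 0 u p := hs.1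
  have hcurl : ∀ τ : ℝ, τ < 0 → ∀ x : EuclideanSpace ℝ (Fin 3), curl (u τ) x = 0 :=
    haulRace_filler haulTravel haulBook h3 ρ hρ u p H c hcls hs (hasLedgerFlows_of_slabBoundedSwirlFree u p hs)
  refine PastIrrotational.ae_eq_zero_of_gauge_of_pastIrrotational hρ hρ2 hcls.1 hcls.2.1 hcls.2.2 le_rfl (fun τ hτ => ?_)
    (fun τ hτ => hcl.divFree τ hτ) hcurl
  exact (hcl.contDiff_velocity hτ).of_le (by norm_cast)

/-- ★★ **THE CASIMIR MEMBER** (LEAD 19832 v115 binder `¬ IsSlabBoundedSwirlFree u p`; `InClass`, `IsSlabBoundedSwirlFree`, `VanishesAE` δ-unfolded):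
every member `(u, p, H, c)` of the crux class with `0 < ρ ≤ ½` that is classical on the open past with axisymmetric swirl-free slices and velocity
bounded on compact past slabs VANISHES a.e. on `(−∞,0) × ℝ³` — `slabBoundedSwirlFree_trivial_of_haulingInequality` applied to ns-ezl-w2's landed
hauling inequality `CasimirHaul.haulingInequality` (H3).  With the containments of `…CasimirHaulStrata` this kills, inside the class, the strata
`IsSwirlFreeDrifting`, `IsSwirlFreeDriftingWith`, `IsSwirlFreeSlowDrifting`, `IsMirrorOutgoing` and the swirl-free `IsAxisymSlowDrifting` members at once.
The wall H6 (the class minus this stratum) stays OPEN. [cite: CaffarelliKohnNirenberg1982, §2; MajdaBertozziCUP2002, §2.3.3] -/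
theorem slabBoundedSwirlFree_trivial {ρ : ℝ} (hρ : 0 < ρ) (hρ2 : ρ ≤ 1 / 2)
    {u : ℝ → EuclideanSpace ℝ (Fin 3) → EuclideanSpace ℝ (Fin 3)} {p : ℝ → EuclideanSpace ℝ (Fin 3) → ℝ}
    {H : ℝ → EuclideanSpace ℝ (Fin 3) → EuclideanSpace ℝ (Fin 3) →L[ℝ] EuclideanSpace ℝ (Fin 3)} {c : ℝ≥0}
    (hcls : IsSuitableWeakSolutionOn (slab (EuclideanSpace ℝ (Fin 3)) (Set.Iio 0) isOpen_Iio) 0 0 u p ∧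
      HasWeakSpatialGradientOn (slab (EuclideanSpace ℝ (Fin 3)) (Set.Iio 0) isOpen_Iio) u H ∧
      (∀ a : ℝ, 0 < a →
        ENNReal.ofReal (a ^ (2 * ρ)) * cknA a (0 : ℝ × EuclideanSpace ℝ (Fin 3)) u +
            ENNReal.ofReal (a ^ ρ) * cknE a (0 : ℝ × EuclideanSpace ℝ (Fin 3)) H +
          ENNReal.ofReal (a ^ (2 * ρ)) * cknD a (0 : ℝ × EuclideanSpace ℝ (Fin 3)) p ≤ (c : ℝ≥0∞)))
    (hs : IsClassicalEulerSolutionOn (Set.Iio 0) 0 u p ∧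
      (∀ τ : ℝ, τ < 0 → IsAxisymmetric (u τ) ∧ HasNoSwirl (u τ)) ∧
      (∀ T₁ T₀ : ℝ, T₁ ≤ T₀ → T₀ < 0 → ∃ B : ℝ, ∀ τ ∈ Set.Icc T₁ T₀, ∀ x : EuclideanSpace ℝ (Fin 3), ‖u τ x‖ ≤ B)) :
    Function.uncurry u =ᵐ[volume.restrict (Set.Iio (0 : ℝ) ×ˢ (Set.univ : Set (EuclideanSpace ℝ (Fin 3))))] 0 :=
  slabBoundedSwirlFree_trivial_of_haulingInequality haulingInequality hρ hρ2 hcls hs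

end Summit.NavierStokesRegularity.NavierStokesRegularity.Theorems.PowerGaugeEulerLiouville.CasimirHaul

end
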